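import Literature.NumberTheory.Transcendental.NesterenkoMultiplicity
import HarnessLib

/-!
# Nesterenko's multiplicity estimate (LNM 1752 Ch. 10 Thm 1.1): identity (41) and its consequences — proofs only

`Literature/NumberTheory/Transcendental/NesterenkoMultiplicityProofs.lean` — proofs only (no
definitions, no named facts, nothing asserted).  First bricks of the discharge of the named fact
`NesterenkoMultiplicity.NesterenkoPhilippon2001_ch10_thm_1_1` (`NesterenkoMultiplicity.lean`:
Yu. V. Nesterenko, Ch. 10 of Nesterenko–Philippon (eds.), LNM 1752 (2001), Theorem 1.1), following
the printed proof, which starts (§1, p. 150) from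

* the identity **(41)** `DE(z, f̄) = A₀(z, f̄) d/dz E(z, f̄)` for a solution `f̄` of the system (39)
  and the operator `D` of (40) — `substSeries_dOp` (the chain rule, by induction on `E`);
* its consequence "functions having the `D`-property are algebraically independent over `ℂ(z)`"
  (p. 150: the ideal `𝔈 = {E | E(z, f̄) = 0}` is prime, `D`-stable by (41), and all its members
  have infinite order, so the `D`-property forces `𝔈 = (0)`) —
  `isDStable_ker_substSeries`, `isPrime_ker_substSeries`, `substSeries_ne_zero_of_hasDProperty`,
  `order_substSeries_lt_top_of_hasDProperty`;
* the order count **(67)** (p. 161) in its general form: by (41), `D` lowers the order along `f̄`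
  by at most one, `ord E(z, f̄) ≤ ord (DᵏE)(z, f̄) + k` —
  `order_substSeries_le_order_dOp_add_one`, `order_substSeries_le_order_dOp_iterate_add`.

## References

* [NesterenkoPhilippon2001] Yu. V. Nesterenko, P. Philippon (eds.), *Introduction to Algebraic
  Independence Theory*, LNM 1752, Springer 2001, Ch. 10 (Yu. V. Nesterenko) §1: (39)–(41),
  Definition 1.2, Theorem 1.1 and the paragraph "Note that functions having the `D`-property are
  algebraically independent over `ℂ(z)`" (pp. 149–150); §3 (67) (p. 161).
-/

noncomputable section

open MvPolynomial

namespace Literature.NumberTheory.Transcendental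

namespace NesterenkoMultiplicity

variable {m : ℕ}

/-- `substSeries` on a variable, in terms of the vector `ḡ = (z, f₁, …, f_m)`. [folklore] -/
theorem substSeries_X (f : Fin m → PowerSeries ℂ) (i : Fin (m + 1)) :
    substSeries f (X i) = (Fin.cons PowerSeries.X f : Fin (m + 1) → PowerSeries ℂ) i :=
  MvPolynomial.aeval_X _ _

/-- For a solution `f̄` of (39): `A_i(z, f̄) = A₀(z, f̄) · g_i'` for every coordinate of
`ḡ = (z, f₁, …, f_m)` (`g₀' = 1`, `g_j' = f_j' = A_j(z, f̄)/A₀(z, f̄)`).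
[cite: NesterenkoPhilippon2001, Ch. 10 §1 (39) (p. 149)] -/
theorem substSeries_apply_eq_mul_derivative (A : Fin (m + 1) → Rzx m) (f : Fin m → PowerSeries ℂ)
    (hf : IsSolution A f) (i : Fin (m + 1)) :
    substSeries f (A i) =
      substSeries f (A 0) *
        PowerSeries.derivative ℂ ((Fin.cons PowerSeries.X f : Fin (m + 1) → PowerSeries ℂ) i) := by
  refine Fin.cases ?_ (fun j => ?_) i
  · simp
  · simpa using (hf.2 j).symm

/-- **Identity (41)**: if `f̄` is a solution of the system (39) and `E ∈ ℂ[z, x₁, …, x_m]`, then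
`(DE)(z, f̄) = A₀(z, f̄) · d/dz E(z, f̄)` (the chain rule).
[cite: NesterenkoPhilippon2001, Ch. 10 §1 (41) (p. 150)] -/
theorem substSeries_dOp (A : Fin (m + 1) → Rzx m) (f : Fin m → PowerSeries ℂ)
    (hf : IsSolution A f) (E : Rzx m) :
    substSeries f (dOp A E) =
      substSeries f (A 0) * PowerSeries.derivative ℂ (substSeries f E) := by
  induction E using MvPolynomial.induction_on with
  | C a =>
    have h0 : dOp A (C a) = 0 := by simp [dOp]
    rw [h0, map_zero, substSeries, MvPolynomial.aeval_C, Derivation.map_algebraMap, mul_zero]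
  | add p q hp hq => rw [dOp_add, map_add, hp, hq, map_add, map_add, mul_add]
  | mul_X p i hp =>
    rw [dOp_mul, dOp_X, map_add, map_mul, map_mul, hp, substSeries_apply_eq_mul_derivative A f hf i,
      map_mul, substSeries_X, Derivation.leibniz, smul_eq_mul, smul_eq_mul]
    ring

/-- The ideal `𝔈 = {E | E(z, f̄) = 0}` of algebraic relations of `z, f₁, …, f_m` is stable under
`D` (by (41)). [cite: NesterenkoPhilippon2001, Ch. 10 §1 (p. 150)] -/
theorem isDStable_ker_substSeries (A : Fin (m + 1) → Rzx m) (f : Fin m → PowerSeries ℂ)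
    (hf : IsSolution A f) : IsDStable A (RingHom.ker (substSeries f)) := by
  intro E hE
  rw [RingHom.mem_ker] at hE ⊢
  rw [substSeries_dOp A f hf, hE, map_zero, mul_zero]

/-- The ideal `𝔈` of algebraic relations is prime (`ℂ⟦z⟧` is a domain).
[cite: NesterenkoPhilippon2001, Ch. 10 §1 (p. 150)] -/
theorem isPrime_ker_substSeries (f : Fin m → PowerSeries ℂ) :
    (RingHom.ker (substSeries f)).IsPrime :=
  RingHom.ker_isPrime _

/-- **Functions with the `D`-property are algebraically independent over `ℂ(z)`** (p. 150): for a
solution `f̄` of (39) with the `D`-property at `0` and every non-zero `E ∈ ℂ[z, x₁, …, x_m]`,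
`E(z, f̄(z)) ≢ 0`. ("if functions `f̄` are algebraically dependent … the ideal `𝔈 ≠ (0)`
satisfies `D𝔈 ⊂ 𝔈` and for any polynomial `E ∈ 𝔈` one has `ord E(z, f̄) = ∞`.")
[cite: NesterenkoPhilippon2001, Ch. 10 §1 (p. 150)] -/
theorem substSeries_ne_zero_of_hasDProperty (A : Fin (m + 1) → Rzx m) (f : Fin m → PowerSeries ℂ)
    (hf : IsSolution A f) (hD : HasDProperty A f) {E : Rzx m} (hE : E ≠ 0) :
    substSeries f E ≠ 0 := by
  intro h0
  obtain ⟨c, hc⟩ := hD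
  have hne : RingHom.ker (substSeries f) ≠ ⊥ := by
    intro hbot
    have hmem : E ∈ RingHom.ker (substSeries f) := (RingHom.mem_ker).mpr h0
    rw [hbot, Ideal.mem_bot] at hmem
    exact hE hmem
  obtain ⟨E', hE', hord⟩ :=
    hc _ (isPrime_ker_substSeries f) hne (isDStable_ker_substSeries A f hf)
  rw [RingHom.mem_ker] at hE'
  rw [hE', PowerSeries.order_zero, top_le_iff] at hord
  exact ENat.coe_ne_top c hord

/-- With the `D`-property every `E ≠ 0` has FINITE order along `f̄`: `ord E(z, f̄) < ∞`.
[cite: NesterenkoPhilippon2001, Ch. 10 §1 (p. 150)] -/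
theorem order_substSeries_lt_top_of_hasDProperty (A : Fin (m + 1) → Rzx m)
    (f : Fin m → PowerSeries ℂ) (hf : IsSolution A f) (hD : HasDProperty A f) {E : Rzx m}
    (hE : E ≠ 0) : (substSeries f E).order < ⊤ :=
  PowerSeries.order_finite_iff_ne_zero.mpr (substSeries_ne_zero_of_hasDProperty A f hf hD hE)

/-- Differentiation lowers the order of a power series by at most one: `ord φ ≤ ord φ' + 1`.
[folklore] -/
theorem order_le_order_derivative_add_one (φ : PowerSeries ℂ) :
    φ.order ≤ (PowerSeries.derivative ℂ φ).order + 1 := by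
  by_cases h : PowerSeries.derivative ℂ φ = 0
  · rw [h, PowerSeries.order_zero, top_add]
    exact le_top
  · have hcoeff := PowerSeries.coeff_order h
    set N := (PowerSeries.derivative ℂ φ).order.toNat with hN
    rw [PowerSeries.coeff_derivative] at hcoeff
    have h2 : PowerSeries.coeff (N + 1) φ ≠ 0 := fun h0 => hcoeff (by rw [h0, zero_mul])
    calc φ.order ≤ ((N + 1 : ℕ) : ℕ∞) := PowerSeries.order_le (N + 1) h2
      _ = (PowerSeries.derivative ℂ φ).order + 1 := by
        rw [Nat.cast_add, Nat.cast_one, hN, PowerSeries.coe_toNat_order h]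

/-- **(67) in general form**: along a solution, applying `D` lowers orders by at most one,
`ord (DE)(z, f̄) + 1 ≥ ord E(z, f̄) + ord A₀(z, f̄) ≥ ord E(z, f̄)`.
[cite: NesterenkoPhilippon2001, Ch. 10 (41) (p. 150), (67) (p. 161)] -/
theorem order_substSeries_le_order_dOp_add_one (A : Fin (m + 1) → Rzx m)
    (f : Fin m → PowerSeries ℂ) (hf : IsSolution A f) (E : Rzx m) :
    (substSeries f E).order ≤ (substSeries f (dOp A E)).order + 1 := by
  rw [substSeries_dOp A f hf, PowerSeries.order_mul]
  calc (substSeries f E).order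
      ≤ (PowerSeries.derivative ℂ (substSeries f E)).order + 1 :=
        order_le_order_derivative_add_one _
    _ ≤ (substSeries f (A 0)).order + (PowerSeries.derivative ℂ (substSeries f E)).order + 1 := by
        gcongr
        exact le_add_self

/-- Iterating: `ord E(z, f̄) ≤ ord (DᵏE)(z, f̄) + k`. [cite: NesterenkoPhilippon2001, Ch. 10 (67) (p. 161)] -/
theorem order_substSeries_le_order_dOp_iterate_add (A : Fin (m + 1) → Rzx m)
    (f : Fin m → PowerSeries ℂ) (hf : IsSolution A f) (E : Rzx m) (k : ℕ) :
    (substSeries f E).order ≤ (substSeries f ((dOp A)^[k] E)).order + k := by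
  induction k with
  | zero => simp
  | succ k ih =>
    rw [Function.iterate_succ_apply', Nat.cast_add, Nat.cast_one]
    calc (substSeries f E).order ≤ (substSeries f ((dOp A)^[k] E)).order + k := ih
      _ ≤ (substSeries f (dOp A ((dOp A)^[k] E))).order + 1 + k := by
        gcongr
        exact order_substSeries_le_order_dOp_add_one A f hf _
      _ = (substSeries f (dOp A ((dOp A)^[k] E))).order + (k + 1) := by
        rw [add_assoc, add_comm (1 : ℕ∞)]

end NesterenkoMultiplicity

end Literature.NumberTheory.Transcendental

end
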